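import Literature.NumberTheory.Automorphic.UnitaryGroupArchIntegratedOperatorLieDerivative
import Literature.NumberTheory.Automorphic.UnitaryGroupArchIntegratedOperatorNuclearOfPieces
import HarnessLib

/-!
# The `(1 + Ω_K)`-family of the archimedean integrated operator, in the currency of the V22 assembly skeleton (piece `hfam`, PAID)

Topic `NumberTheory/Automorphic`; namespace `Literature.NumberTheory.Automorphic.UnitaryGroup`; theorems only (no definition, no named fact, no instance, no `sorry`).  Cell
`hodgecm-mathlib`, line T1a, road HC: the hypothesis `hfam` of ★ `archIntegratedOperatorNuclearOfKTypeGrowth_of_pieces` (p830248, lead F0P3b-p01 (g2)) DISCHARGED from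
A-p14 (g22)'s integration-by-parts file ★ `UnitaryGroupArchIntegratedOperatorLieDerivative` (p830250): for an archimedean test function `φ = φ'|_{G′_∞}` the operators
`T j := (ϖ ∘ proj)(archKCasimirTest^[j] φ')` satisfy `T 0 = (ϖ ∘ proj)(φ)` and `T j (v + Ω_K v) = T (j+1) v` on `H_K^∞` (★ `integratedOperator_archProjUForm_apply_add_upqKCasimirVec`)
— in print: `π(f) π((1+ω_K)^j) = π(f(x; E'^j))` [Varadarajan1989, §5.4 proof of Thm. 22], [Knapp1986, (10.4)–(10.6)].

* `archIntegratedOperator_casimirFamily` — the `hfam` text of the skeleton, proved; so V22's in-house payment now rests on `hsum` alone (the `Û(2)×Û(1)` dictionary H4b +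
  ★ hq + ★ lattice + ★ fibre count).

## References
* V. S. Varadarajan, *An Introduction to Harmonic Analysis on Semisimple Lie Groups* (1989), §5.4, proof of Thm. 22 (PDF pp. 160–161) [Varadarajan1989].
* A. W. Knapp, *Representation Theory of Semisimple Groups: An Overview Based on Examples* (1986), Thm. 10.2, (10.4)–(10.6) [Knapp1986].
-/

set_option autoImplicit false

noncomputable section

open NumberField MeasureTheory CompactlySupported
-- `Classical`: the place subtypes indexing `mixedSpace L` are `Fintype` classically, as in ★ `UnitaryGroupArchCharacterTraceClass` (token-for-token binder match).
open scoped Matrix InnerProductSpace ENNReal NNReal Classical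

namespace Literature.NumberTheory.Automorphic.UnitaryGroup

open Literature.RepresentationTheory.KonnoKonno2007 Literature.RepresentationTheory.KonnoKonno2007.RealDualPair

/-- **THE `(1 + Ω_K)`-FAMILY (piece `hfam` of the V22 skeleton, PAID)**: for every CM frame, Haar `νinf`, unitary strongly continuous `ϖ` of `U(2,1)` on `E` and
archimedean test function `φ = φ'|_{G′_∞}`, and every `n`, there is `T : ℕ → (E →L E)` with `T 0 = (ϖ ∘ archProjUForm)(φ)` and `T j (v + Ω_K v) = T (j+1) v` for `j < n`,
`v ∈ H_K^∞` — namely `T j = (ϖ ∘ archProjUForm)(archKCasimirTest^[j] φ')` (A-p14 ★ p830250). [cite: Varadarajan1989, §5.4 (proof of Thm. 22)] [cite: Knapp1986, Thm. 10.2, (10.4)–(10.6)] -/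
theorem archIntegratedOperator_casimirFamily
    (L : Type) [Field L] [NumberField L] [IsCMField L] (ι : L →+* ℂ) (H : Matrix (Fin 3) (Fin 3) L) (T : GL (Fin 3) ℂ)
    (hT : (T : Matrix (Fin 3) (Fin 3) ℂ)ᴴ * H.map ι * (T : Matrix (Fin 3) (Fin 3) ℂ) = Literature.Geometry.ComplexHyperbolic.BallModel.J)
    (νinf : @Measure (arch (↥(maximalRealSubfield L)) L (IsCMField.complexConj L) 3 H) (borel _)) :
    letI : MeasurableSpace (arch (↥(maximalRealSubfield L)) L (IsCMField.complexConj L) 3 H) := borel _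
    haveI : BorelSpace (arch (↥(maximalRealSubfield L)) L (IsCMField.complexConj L) 3 H) := ⟨rfl⟩
    ∀ (_hν : νinf.IsHaarMeasure)
      (E : Type) [NormedAddCommGroup E] [InnerProductSpace ℂ E] [CompleteSpace E]
      (ϖ : ContRepresentation ℂ (uFormGroup (Fin 2) (Fin 1)).carrier E) (hu : ϖ.IsUnitary) (hc : ϖ.IsStronglyContinuous)
      (φ : arch (↥(maximalRealSubfield L)) L (IsCMField.complexConj L) 3 H → ℂ) (hφc : Continuous φ) (hφs : HasCompactSupport φ),
      (∃ φ' : GL (Fin 3) (NumberField.mixedEmbedding.mixedSpace L) → ℂ, Continuous φ' ∧ HasCompactSupport φ' ∧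
          IsArchSmooth (archGroupGL 3 L).carrier.subtype φ' ∧
          ∀ k : arch (↥(maximalRealSubfield L)) L (IsCMField.complexConj L) 3 H,
            φ k = φ' (k : GL (Fin 3) (NumberField.mixedEmbedding.mixedSpace L))) →
      ∀ n : ℕ, ∃ Tf : ℕ → (E →L[ℂ] E),
        Tf 0 = (ϖ.restrict (archProjUForm L ι H T hT)).integratedOperator (hu.restrict _)
          (hc.restrict _ (continuous_archProjUForm L ι H T hT)) νinf ⟨⟨φ, hφc⟩, hφs⟩ ∧
        ∀ j < n, ∀ v ∈ harishChandraSpace (uFormGroup (Fin 2) (Fin 1)) ϖ, Tf j (v + upqKCasimirVec ϖ v) = Tf (j + 1) v := by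
  intro hν E _ _ _ ϖ hu hc φ hφc hφs hφ' n
  letI : MeasurableSpace (arch (↥(maximalRealSubfield L)) L (IsCMField.complexConj L) 3 H) := borel _
  haveI : BorelSpace (arch (↥(maximalRealSubfield L)) L (IsCMField.complexConj L) 3 H) := ⟨rfl⟩
  obtain ⟨φ', hφ'c, hφ's, hφ'sm, hφeq⟩ := hφ'
  have hψ : IsArchTestFunction 3 L φ' := ⟨hφ'c, hφ's, hφ'sm⟩
  refine ⟨fun j => (ϖ.restrict (archProjUForm L ι H T hT)).integratedOperator (hu.restrict _)
      (hc.restrict _ (continuous_archProjUForm L ι H T hT)) νinf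
      (archRestrict L H ((archKCasimirTest L ι T)^[j] φ') (isArchTestFunction_iterate_archKCasimirTest L ι T hψ j).continuous
        (isArchTestFunction_iterate_archKCasimirTest L ι T hψ j).hasCompactSupport), ?_, ?_⟩
  · -- `T 0 = (ϖ ∘ proj)(φ)`: the two test functions agree pointwise
    have h0 : archRestrict L H ((archKCasimirTest L ι T)^[0] φ') (isArchTestFunction_iterate_archKCasimirTest L ι T hψ 0).continuous
          (isArchTestFunction_iterate_archKCasimirTest L ι T hψ 0).hasCompactSupport =
        (⟨⟨φ, hφc⟩, hφs⟩ : C_c(arch (↥(maximalRealSubfield L)) L (IsCMField.complexConj L) 3 H, ℂ)) := by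
      ext k
      rw [archRestrict_apply, Function.iterate_zero, id_eq]
      exact (hφeq k).symm
    beta_reduce
    rw [h0]
  · intro j _ v hv
    change (ϖ.restrict (archProjUForm L ι H T hT)).integratedOperator (hu.restrict _)
        (hc.restrict _ (continuous_archProjUForm L ι H T hT)) νinf
        (archRestrict L H ((archKCasimirTest L ι T)^[j] φ') (isArchTestFunction_iterate_archKCasimirTest L ι T hψ j).continuous
          (isArchTestFunction_iterate_archKCasimirTest L ι T hψ j).hasCompactSupport) (v + upqKCasimirVec ϖ v) =
      (ϖ.restrict (archProjUForm L ι H T hT)).integratedOperator (hu.restrict _)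
        (hc.restrict _ (continuous_archProjUForm L ι H T hT)) νinf
        (archRestrict L H ((archKCasimirTest L ι T)^[j + 1] φ') (isArchTestFunction_iterate_archKCasimirTest L ι T hψ (j + 1)).continuous
          (isArchTestFunction_iterate_archKCasimirTest L ι T hψ (j + 1)).hasCompactSupport) v
    simp only [Function.iterate_succ_apply']
    exact integratedOperator_archProjUForm_apply_add_upqKCasimirVec L ι H T hT ϖ νinf hu hc
      (isArchTestFunction_iterate_archKCasimirTest L ι T hψ j) hv.1

/-- **V22 ⇐ `hsum` ALONE**: with `hfam` paid, the letter ★ `ArchIntegratedOperatorNuclearOfKTypeGrowth L ι H T hT νinf` follows from the block Casimir-weight summability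
`hsum` of the skeleton (★ `archIntegratedOperatorNuclearOfKTypeGrowth_of_pieces`). [cite: Varadarajan1989, §5.4 Thm. 22] [cite: Knapp1986, Thm. 10.2] -/
theorem archIntegratedOperatorNuclearOfKTypeGrowth_of_hsum
    (L : Type) [Field L] [NumberField L] [IsCMField L] (ι : L →+* ℂ) (H : Matrix (Fin 3) (Fin 3) L) (T : GL (Fin 3) ℂ)
    (hT : (T : Matrix (Fin 3) (Fin 3) ℂ)ᴴ * H.map ι * (T : Matrix (Fin 3) (Fin 3) ℂ) = Literature.Geometry.ComplexHyperbolic.BallModel.J)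
    (νinf : @Measure (arch (↥(maximalRealSubfield L)) L (IsCMField.complexConj L) 3 H) (borel _))
    (hsum : ∀ (E : Type) [NormedAddCommGroup E] [InnerProductSpace ℂ E] [CompleteSpace E]
        (ϖ : ContRepresentation ℂ (uFormGroup (Fin 2) (Fin 1)).carrier E) (_hu : ϖ.IsUnitary) (_hc : ϖ.IsStronglyContinuous),
        (∃ (c : ℝ) (r : ℕ), ∀ (W : Type) [AddCommGroup W] [Module ℂ W] [FiniteDimensional ℂ W]
            (τ : Representation ℂ (uFormGroup (Fin 2) (Fin 1)).maximalCompact W), τ.IsIrreducible →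
            FiniteDimensional ℂ (Representation.homRangeSum
                (ϖ.restrict (Subgroup.inclusion (uFormGroup (Fin 2) (Fin 1)).maximalCompact_le_carrier)).toRepresentation τ) ∧
              (Module.finrank ℂ (Representation.homRangeSum
                  (ϖ.restrict (Subgroup.inclusion (uFormGroup (Fin 2) (Fin 1)).maximalCompact_le_carrier)).toRepresentation τ) : ℝ) ≤
                c * (Module.finrank ℂ W : ℝ) ^ r) →
        ∀ S : Set (ContRepresentation.ClosedSubrep (ϖ.restrict (Subgroup.inclusion (uFormGroup (Fin 2) (Fin 1)).maximalCompact_le_carrier))),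
          S.Pairwise (fun W W' => W.toSubmodule ⟂ W'.toSubmodule) →
          (∀ W ∈ S, W.toContRep.IsTopIrreducible) → (∀ W ∈ S, FiniteDimensional ℂ W.toSubmodule) →
          (∀ W ∈ S, W.toSubmodule ≤ harishChandraSpace (uFormGroup (Fin 2) (Fin 1)) ϖ) →
          ∃ n : ℕ, Summable fun W : S =>
            (Module.finrank ℂ (W : ContRepresentation.ClosedSubrep
              (ϖ.restrict (Subgroup.inclusion (uFormGroup (Fin 2) (Fin 1)).maximalCompact_le_carrier))).toSubmodule : ℝ) *
              ((1 + upqKBlockScalar ϖ (W : ContRepresentation.ClosedSubrep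
                (ϖ.restrict (Subgroup.inclusion (uFormGroup (Fin 2) (Fin 1)).maximalCompact_le_carrier))).toSubmodule) ^ n)⁻¹) :
    ArchIntegratedOperatorNuclearOfKTypeGrowth L ι H T hT νinf :=
  archIntegratedOperatorNuclearOfKTypeGrowth_of_pieces L ι H T hT νinf (archIntegratedOperator_casimirFamily L ι H T hT νinf) hsum

end Literature.NumberTheory.Automorphic.UnitaryGroup

end
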